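import Mathlib
import Summits.NavierStokesRegularity.NavierStokesRegularity.Theorems.EulerZoomLiouvillePowerGaugeEulerLiouvilleNeedleClockReduction
import Summits.NavierStokesRegularity.NavierStokesRegularity.Theorems.EulerZoomLiouvillePowerGaugeEulerLiouvilleNeedleClockThresholdMember
import HarnessLib.Audit

/-!
# Crux E `EulerZoomLiouville.PowerGaugeEulerLiouville` — THE HOVERING THRESHOLD AT MEMBER LEVEL (ROUND-39 (CR) ∘ ROUND-38
# (T_pow) ∘ (K″)): Bernoulli oscillation exponent `θ < 2+ρ` + a hovering law ⇒ the `C²` needle is trivial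

Route №10 `EulerZoomLiouville` (NavierStokesRegularity), crux E = stmt-NavierStokesRegularity-19832, registered residue
`stub_selfSimilarC2Needle`; memos ROUND-38/39 of the cell `ns-regularity-ideate` (text custody nsreg-p2 g33).  By-name assembly:
classical pressure of the `C²` profile (`WeakToClassical.exists_isSelfSimilarEulerProfile_of_contDiff`) → for every `c′ > 0` the
clock reduction `NeedleRace.effectiveClock_of_hoveringLaw` at scale `δ(R) = R^{−(2+ρ−θ)/4}` (room condition from `θ < 2+ρ`) →
`NeedleRace.selfSimilar_ae_eq_zero_of_subcriticalClockC2` ((K″) t39d + (T_pow)).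

* **`selfSimilar_ae_eq_zero_of_hoveringLawC2`** — crux hypotheses verbatim (`0 < ρ ≤ ½`) + exact self-similarity with a `C²`
  profile `V` + for every classical pressure `P′` of `V` a BERNOULLI OSCILLATION bound `ℋ_{P′}(y) − ℋ_{P′}(y′) ≤ C r^θ` on `B̄_r`
  (`r ≥ 1`) with `θ < 2+ρ` + the HOVERING LAW at every strength `c′R^{2+ρ}` and scale `δ(R) = R^{−(2+ρ−θ)/4}` (around every vortical
  point a ball `B`: for large `R` and every `C²` cut-off copy, the labels of `B` lingering in `‖·‖ ≤ 2R` during `[0, c′R^{2+ρ}]` and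
  spending half that time where `‖W‖ < δ(R)` have volume `≤ |B|/4`) ⇒ `u = 0` a.e.  ROUND-39's reduction as ONE binder: the needle's
  open content is the hovering law near the nodal set (plus `θ_ℋ < 2+ρ`).

NOT NS, not E: a conditional threshold; 19832 OPEN.  References: Constantin–Ignatova–Vicol arXiv:2602.17570 §3.4 (3.31)
[ConstantinIgnatovaVicol2026Putative].
-/

noncomputable section

-- the summit and its single problem share the name `NavierStokesRegularity` (D-0017 nested layout)
set_option linter.dupNamespace false

open Set Filter Topology Metric Function MeasureTheory InnerProductSpace
open scoped RealInnerProductSpace NNReal ENNReal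

namespace Summit.NavierStokesRegularity.NavierStokesRegularity.Theorems.PowerGaugeEulerLiouville.NeedleRace

open Literature.Analysis Literature.Analysis.FluidPDE
open Summit.NavierStokesRegularity.NavierStokesRegularity.Theorems.PowerGaugeEulerLiouville

variable {V : EuclideanSpace ℝ (Fin 3) → EuclideanSpace ℝ (Fin 3)}

/-- **The room condition from `θ < 2 + ρ`** at scale `δ(R) = R^{−(2+ρ−θ)/4}`: for `0 ≤ C`, `0 < κ` (= `(1−2γ)c′`) and all large
`R`, `2^{2+θ} C R^θ ≤ κ (R^{−(2+ρ−θ)/4})² R^{2+ρ}`. [folklore] -/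
theorem room_of_lt {θ ρ C κ : ℝ} (hθ : θ < 2 + ρ) (hC : 0 ≤ C) (hκ : 0 < κ) :
    ∃ R₁ : ℝ, ∀ R : ℝ, R₁ ≤ R →
      (2 : ℝ) ^ (2 + θ) * C * R ^ θ ≤ κ * (R ^ (-((2 + ρ - θ) / 4))) ^ 2 * R ^ (2 + ρ) := by
  set q : ℝ := (2 + ρ - θ) / 2 with hq
  have hq0 : 0 < q := by rw [hq]; linarith
  set A : ℝ := (2 : ℝ) ^ (2 + θ) * C / κ with hA
  have hA0 : 0 ≤ A := by rw [hA]; positivity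
  -- `R₁` with `R₁ ^ q ≥ A`
  set R₁ : ℝ := max 1 ((A + 1) ^ (1 / q)) with hR₁
  refine ⟨R₁, fun R hR => ?_⟩
  have hR1 : 1 ≤ R := (le_max_left _ _).trans hR
  have hR0 : 0 < R := by linarith
  have hRq : A ≤ R ^ q := by
    have h1 : (A + 1) ^ (1 / q) ≤ R := (le_max_right _ _).trans hR
    have h2 : ((A + 1) ^ (1 / q)) ^ q ≤ R ^ q := Real.rpow_le_rpow (by positivity) h1 hq0.le
    rw [← Real.rpow_mul (by linarith), one_div_mul_cancel hq0.ne', Real.rpow_one] at h2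
    linarith
  -- the exponent bookkeeping: `(R^{−q/2})² R^{2+ρ} = R^{q+θ}` and `R^θ R^q = R^{q+θ}`
  have hsq0 : (R ^ (-((2 + ρ - θ) / 4))) ^ 2 * R ^ (2 + ρ) = R ^ q * R ^ θ := by
    rw [← Real.rpow_natCast, ← Real.rpow_mul hR0.le, ← Real.rpow_add hR0, ← Real.rpow_add hR0]
    congr 1
    rw [hq]; push_cast; ring
  have hsq : κ * (R ^ (-((2 + ρ - θ) / 4))) ^ 2 * R ^ (2 + ρ) = κ * (R ^ q * R ^ θ) := by
    rw [mul_assoc, hsq0]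
  rw [hsq]
  have hκq : (2 : ℝ) ^ (2 + θ) * C = κ * A := by rw [hA]; field_simp
  rw [hκq]
  have hθ0 : 0 ≤ R ^ θ := Real.rpow_nonneg hR0.le _
  calc κ * A * R ^ θ ≤ κ * R ^ q * R ^ θ := by gcongr
    _ = κ * (R ^ q * R ^ θ) := by ring

/-- **THE HOVERING THRESHOLD AT MEMBER LEVEL (ROUND-39 (CR) ∘ (T_pow) ∘ (K″)).**  See the module docstring.
[cite: ConstantinIgnatovaVicol2026Putative, §3.4.2 eq. (3.31)] -/
theorem selfSimilar_ae_eq_zero_of_hoveringLawC2 {ρ : ℝ} (hρ : 0 < ρ) (hρ1 : ρ ≤ 1 / 2)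
    {u : ℝ → EuclideanSpace ℝ (Fin 3) → EuclideanSpace ℝ (Fin 3)} {p : ℝ → EuclideanSpace ℝ (Fin 3) → ℝ}
    {H : ℝ → EuclideanSpace ℝ (Fin 3) → EuclideanSpace ℝ (Fin 3) →L[ℝ] EuclideanSpace ℝ (Fin 3)} {c : ℝ≥0}
    (hsw : IsSuitableWeakSolutionOn (slab (EuclideanSpace ℝ (Fin 3)) (Iio 0) isOpen_Iio) 0 0 u p)
    (hH : HasWeakSpatialGradientOn (slab (EuclideanSpace ℝ (Fin 3)) (Iio 0) isOpen_Iio) u H)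
    (hgauge : ∀ a : ℝ, 0 < a →
      ENNReal.ofReal (a ^ (2 * ρ)) * cknA a (0 : ℝ × EuclideanSpace ℝ (Fin 3)) u +
          ENNReal.ofReal (a ^ ρ) * cknE a (0 : ℝ × EuclideanSpace ℝ (Fin 3)) H +
        ENNReal.ofReal (a ^ (2 * ρ)) * cknD a (0 : ℝ × EuclideanSpace ℝ (Fin 3)) p ≤ (c : ℝ≥0∞))
    {P : EuclideanSpace ℝ (Fin 3) → ℝ}
    (hu : ∀ τ : ℝ, τ < 0 → u τ = selfSimilarCollapse (1 / (2 + ρ)) 0 V τ)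
    (hp : ∀ τ : ℝ, τ < 0 → p τ = selfSimilarCollapsePressure (1 / (2 + ρ)) 0 P τ)
    (hV : ContDiff ℝ 2 V) {θ : ℝ} (hθ : θ < 2 + ρ)
    (hosc : ∀ P' : EuclideanSpace ℝ (Fin 3) → ℝ, IsSelfSimilarEulerProfile (1 / (2 + ρ)) 0 V P' →
      ∃ C : ℝ, ∀ r : ℝ, 1 ≤ r → ∀ y y' : EuclideanSpace ℝ (Fin 3), ‖y‖ ≤ r → ‖y'‖ ≤ r →
        selfSimilarBernoulli (1 / (2 + ρ)) 0 V P' y - selfSimilarBernoulli (1 / (2 + ρ)) 0 V P' y' ≤ C * r ^ θ)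
    (hhover : ∀ c' : ℝ, 0 < c' → ∀ x₀ : EuclideanSpace ℝ (Fin 3), curl V x₀ ≠ 0 → ∃ r : ℝ, 0 < r ∧ ∃ R₀ : ℝ,
      ∀ R : ℝ, R₀ ≤ R → ∀ (V' : EuclideanSpace ℝ (Fin 3) → EuclideanSpace ℝ (Fin 3)) (K Rbig : ℝ), ContDiff ℝ 2 V' →
        (∀ y, ‖fderiv ℝ V' y‖ ≤ K) → 2 * R < Rbig → (∀ w ∈ ball (0 : EuclideanSpace ℝ (Fin 3)) Rbig, V' w = V w) →
        (volume (ball x₀ r ∩ {a | ∀ σ ∈ Icc 0 (c' * R ^ (2 + ρ)),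
            ‖ODE.evolutionMap (fun _ : ℝ => selfSimilarTransport (1 / (2 + ρ)) 0 V') 0 (-σ) a‖ ≤ 2 * R} ∩
          {a | c' * R ^ (2 + ρ) / 2 ≤ (volume {σ ∈ Icc 0 (c' * R ^ (2 + ρ)) |
            ‖selfSimilarTransport (1 / (2 + ρ)) 0 V'
                (ODE.evolutionMap (fun _ : ℝ => selfSimilarTransport (1 / (2 + ρ)) 0 V') 0 (-σ) a)‖ <
              R ^ (-((2 + ρ - θ) / 4))}).toReal})).toReal ≤ (volume (ball x₀ r)).toReal / 4) :
    uncurry u =ᵐ[volume.restrict (Iio (0 : ℝ) ×ˢ (univ : Set (EuclideanSpace ℝ (Fin 3))))] 0 := by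
  -- boilerplate: the classical pressure of the `C²` profile (as in `…NeedleRaceMember`)
  have hρ1' : ρ < 1 := by linarith
  have h2ρ : (0 : ℝ) < 2 + ρ := by linarith
  have hγ : (0 : ℝ) < 1 / (2 + ρ) := one_div_pos.2 h2ρ
  have hγ2 : 1 / (2 + ρ) < 1 / 2 := one_div_lt_one_div_of_lt two_pos (by linarith)
  have hD : ∀ a : ℝ, 0 < a → ENNReal.ofReal (a ^ (2 * ρ)) *
      cknD a (0 : ℝ × EuclideanSpace ℝ (Fin 3)) p ≤ (c : ℝ≥0∞) :=
    fun a ha => le_trans le_add_self (hgauge a ha)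
  have hpm : AEStronglyMeasurable (uncurry p)
      (volume.restrict (Iio (0 : ℝ) ×ˢ (univ : Set (EuclideanSpace ℝ (Fin 3))))) := by
    have := hsw.distributional.2.2.1.aestronglyMeasurable
    simpa [slab] using this
  have hPm := aestronglyMeasurable_pressureProfile hpm hp
  have hDprof := profile_pressure_weight_of_gaugeD hρ hρ1' hpm hp hD
  have hP1 : LocallyIntegrable P volume :=
    EnergySaturation.locallyIntegrable_pressure_of_weight hρ1' hPm
      (ENNReal.mul_ne_top ENNReal.ofReal_ne_top ENNReal.coe_ne_top) hDprof
  obtain ⟨P', hprof⟩ :=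
    WeakToClassical.exists_isSelfSimilarEulerProfile_of_contDiff hsw.distributional hu hp hV hP1
  obtain ⟨C, hoscC⟩ := hosc P' hprof
  have hC0 : 0 ≤ C := nonneg_of_bernoulliOsc hoscC
  -- the clock at every strength `c′ R^{2+ρ}` by the clock reduction
  refine selfSimilar_ae_eq_zero_of_subcriticalClockC2 hρ hρ1 hsw hH hgauge hu hp hV (fun c' hc' => ?_)
  have h12 : 0 < 1 - 2 * (1 / (2 + ρ)) := by linarith
  obtain ⟨R₁, hR₁⟩ := room_of_lt (ρ := ρ) hθ hC0 (mul_pos h12 hc')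
  have hroom : ∃ R₁ : ℝ, ∀ R : ℝ, R₁ ≤ R →
      (2 : ℝ) ^ (2 + θ) * C * R ^ θ ≤ (1 - 2 * (1 / (2 + ρ))) * c' * (R ^ (-((2 + ρ - θ) / 4))) ^ 2 * R ^ (2 + ρ) :=
    ⟨max R₁ 1, fun R hR => by
      have h := hR₁ R ((le_max_left _ _).trans hR)
      linarith [h]⟩
  exact effectiveClock_of_hoveringLaw (e := 2 + ρ) hprof hγ2 hc' hoscC
    (fun R hR => Real.rpow_pos_of_pos (by linarith) _) hroom (hhover c' hc')
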